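import Mathlib

/-!
# No element of order `p` above a non-trivial unipotent modulo `p²`

Solo seat `solo-Langlands-informed`, session 47 (FINDING_E §3(i), the field-degree count behind the
verdict that the Cassels–Tate value deciding bit (B) lives on the mod-`49` adjoint module).

In any ring `R` in which the natural number `p` satisfies `(p : R) * (p : R) = 0` (for instance
`R = M₂(ℤ/p²)`), an element `X = N + p * A` with `N * N = 0` satisfies `X² = p (NA + AN)`,
`X³ = p (NAN)`, `X⁴ = 0`, and, if `p` is a prime `≥ 5`, `(1 + X) ^ p = 1 + p * N`.
Consequently a residually unipotent element `1 + N` with `p * N ≠ 0` admits NO lift of order `p`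
modulo `p²`: the image of a mod-`p²` Galois representation whose reduction contains a non-trivial
unipotent has `p`-Sylow subgroup of order at least `p²` (applied with `p = 7` to `ρ_g mod 49`).
Elementary; no citation needed.
-/

namespace Summit.Langlands.Langlands.Theorems

section NoOrderPLift

variable {R : Type*} [Ring R]

/-- `(N + pA)(N + pA) = p(NA + AN)` when `p·p = 0` and `N·N = 0` (`p` a natural number, hence central). -/
theorem unipotentLift_sq (p : ℕ) (N A : R) (hpp : (p : R) * (p : R) = 0) (hN : N * N = 0) :
    (N + (p : R) * A) * (N + (p : R) * A) = (p : R) * (N * A + A * N) := by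
  have hc : ∀ x : R, (p : R) * x = x * (p : R) := fun x => (Nat.cast_commute p x).eq
  have e1 : N * ((p : R) * A) = (p : R) * (N * A) := by
    calc N * ((p : R) * A) = (N * (p : R)) * A := by simp only [mul_assoc]
    _ = ((p : R) * N) * A := by rw [hc N]
    _ = (p : R) * (N * A) := by simp only [mul_assoc]
  have e2 : (p : R) * A * ((p : R) * A) = 0 := by
    calc (p : R) * A * ((p : R) * A) = (p : R) * (A * (p : R)) * A := by simp only [mul_assoc]
    _ = (p : R) * ((p : R) * A) * A := by rw [← hc A]
    _ = ((p : R) * (p : R)) * (A * A) := by simp only [mul_assoc]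
    _ = 0 := by rw [hpp, zero_mul]
  calc (N + (p : R) * A) * (N + (p : R) * A)
      = N * N + N * ((p : R) * A) + ((p : R) * A * N + (p : R) * A * ((p : R) * A)) := by
        rw [add_mul, mul_add, mul_add]
  _ = (p : R) * (N * A) + (p : R) * A * N := by rw [hN, e1, e2, zero_add, add_zero]
  _ = (p : R) * (N * A + A * N) := by simp only [mul_add, mul_assoc]

/-- `X · X² = p(NAN)` for `X = N + pA`. -/
theorem unipotentLift_cube (p : ℕ) (N A : R) (hpp : (p : R) * (p : R) = 0) (hN : N * N = 0) :
    (N + (p : R) * A) * ((N + (p : R) * A) * (N + (p : R) * A)) = (p : R) * (N * A * N) := by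
  have hc : ∀ x : R, (p : R) * x = x * (p : R) := fun x => (Nat.cast_commute p x).eq
  rw [unipotentLift_sq p N A hpp hN, add_mul]
  have f1 : N * ((p : R) * (N * A + A * N)) = (p : R) * (N * A * N) := by
    calc N * ((p : R) * (N * A + A * N)) = (N * (p : R)) * (N * A + A * N) := by
          simp only [mul_assoc]
    _ = ((p : R) * N) * (N * A + A * N) := by rw [hc N]
    _ = (p : R) * ((N * N) * A + N * (A * N)) := by simp only [mul_assoc, mul_add]
    _ = (p : R) * (N * A * N) := by rw [hN, zero_mul, zero_add, mul_assoc]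
  have f2 : (p : R) * A * ((p : R) * (N * A + A * N)) = 0 := by
    calc (p : R) * A * ((p : R) * (N * A + A * N)) = (p : R) * (A * (p : R)) * (N * A + A * N) := by
          simp only [mul_assoc]
    _ = (p : R) * ((p : R) * A) * (N * A + A * N) := by rw [← hc A]
    _ = ((p : R) * (p : R)) * (A * (N * A + A * N)) := by simp only [mul_assoc]
    _ = 0 := by rw [hpp, zero_mul]
  rw [f1, f2, add_zero]

/-- `X · X³ = 0` for `X = N + pA`: the fourth power vanishes. -/
theorem unipotentLift_fourth (p : ℕ) (N A : R) (hpp : (p : R) * (p : R) = 0) (hN : N * N = 0) :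
    (N + (p : R) * A) * ((p : R) * (N * A * N)) = 0 := by
  have hc : ∀ x : R, (p : R) * x = x * (p : R) := fun x => (Nat.cast_commute p x).eq
  rw [add_mul]
  have f1 : N * ((p : R) * (N * A * N)) = 0 := by
    calc N * ((p : R) * (N * A * N)) = (N * (p : R)) * (N * A * N) := by simp only [mul_assoc]
    _ = ((p : R) * N) * (N * A * N) := by rw [hc N]
    _ = (p : R) * ((N * N) * (A * N)) := by simp only [mul_assoc]
    _ = 0 := by rw [hN, zero_mul, mul_zero]
  have f2 : (p : R) * A * ((p : R) * (N * A * N)) = 0 := by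
    calc (p : R) * A * ((p : R) * (N * A * N)) = (p : R) * (A * (p : R)) * (N * A * N) := by
          simp only [mul_assoc]
    _ = (p : R) * ((p : R) * A) * (N * A * N) := by rw [← hc A]
    _ = ((p : R) * (p : R)) * (A * (N * A * N)) := by simp only [mul_assoc]
    _ = 0 := by rw [hpp, zero_mul]
  rw [f1, f2, add_zero]

/-- MAIN: for a prime `p ≥ 5`, `(1 + N + pA)^p = 1 + pN` whenever `p·p = 0` and `N·N = 0`.  In
`M₂(ℤ/p²)` with `N = E₁₂` the right-hand side is `≠ 1`, so no lift of a non-trivial unipotent has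
order `p`. -/
theorem one_add_unipotentLift_pow_prime (p : ℕ) (hp : p.Prime) (h5 : 5 ≤ p) (N A : R)
    (hpp : (p : R) * (p : R) = 0) (hN : N * N = 0) :
    (1 + (N + (p : R) * A)) ^ p = 1 + (p : R) * N := by
  have hc : ∀ x : R, (p : R) * x = x * (p : R) := fun x => (Nat.cast_commute p x).eq
  set X : R := N + (p : R) * A with hX
  have hX2 : X ^ 2 = (p : R) * (N * A + A * N) := by
    rw [pow_two]; exact unipotentLift_sq p N A hpp hN
  have hX3 : X ^ 3 = (p : R) * (N * A * N) := by
    rw [pow_succ', pow_two]; exact unipotentLift_cube p N A hpp hN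
  have hX4 : X ^ 4 = 0 := by
    rw [pow_succ', hX3]; exact unipotentLift_fourth p N A hpp hN
  have hXk : ∀ k, 4 ≤ k → X ^ k = 0 := by
    intro k hk
    obtain ⟨j, rfl⟩ := Nat.exists_eq_add_of_le hk
    rw [pow_add, hX4, zero_mul]
  have hcomm : Commute X 1 := Commute.one_right X
  rw [add_comm (1 : R) X, hcomm.add_pow p]
  simp only [one_pow, mul_one]
  have h4le : 4 ≤ p + 1 := by omega
  rw [← Finset.sum_range_add_sum_Ico (fun m => X ^ m * ((p.choose m : ℕ) : R)) h4le]
  have hz : ∀ m ∈ Finset.Ico 4 (p + 1), X ^ m * ((p.choose m : ℕ) : R) = 0 := by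
    intro m hm
    rw [Finset.mem_Ico] at hm
    rw [hXk m hm.1, zero_mul]
  rw [Finset.sum_eq_zero hz, add_zero]
  simp only [Finset.sum_range_succ, Finset.sum_range_zero, zero_add, pow_zero, one_mul,
    Nat.choose_zero_right, Nat.cast_one, pow_one, Nat.choose_one_right, hX2, hX3]
  -- goal: 1 + X * ↑p + ↑p * (N * A + A * N) * ↑(p.choose 2) + ↑p * (N * A * N) * ↑(p.choose 3)
  --       = 1 + ↑p * N
  have t1 : X * (p : R) = (p : R) * N := by
    have e : (p : R) * A * (p : R) = 0 := by
      calc (p : R) * A * (p : R) = (p : R) * ((p : R) * A) := by rw [mul_assoc, ← hc A]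
      _ = 0 := by rw [← mul_assoc, hpp, zero_mul]
    rw [hX, add_mul, ← hc N, e, add_zero]
  have key : ∀ (k : ℕ) (Y : R), k ≠ 0 → k < p → (p : R) * Y * ((p.choose k : ℕ) : R) = 0 := by
    intro k Y hk hkp
    obtain ⟨c, hck⟩ := hp.dvd_choose_self hk hkp
    rw [hck, Nat.cast_mul]
    calc (p : R) * Y * ((p : R) * (c : R)) = (p : R) * (Y * (p : R)) * (c : R) := by
          simp only [mul_assoc]
    _ = (p : R) * ((p : R) * Y) * (c : R) := by rw [← hc Y]
    _ = ((p : R) * (p : R)) * (Y * (c : R)) := by simp only [mul_assoc]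
    _ = 0 := by rw [hpp, zero_mul]
  have t2 : (p : R) * (N * A + A * N) * ((p.choose 2 : ℕ) : R) = 0 := key 2 _ (by omega) (by omega)
  have t3 : (p : R) * (N * A * N) * ((p.choose 3 : ℕ) : R) = 0 := key 3 _ (by omega) (by omega)
  rw [t1, t2, t3, add_zero, add_zero]

end NoOrderPLift

end Summit.Langlands.Langlands.Theorems
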